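import Summits.KontsevichZagierPeriods.KontsevichZagierPeriods.Theses.LiouvilleUnfolding
import Summits.KontsevichZagierPeriods.KontsevichZagierPeriods.Theorems.KernelFormKernelImpliesStatement

/-!
# Route LiouvilleUnfolding — the assembly `Assembly` (stmt-KontsevichZagierPeriods-2840)

Route `KontsevichZagierPeriods/LiouvilleUnfolding` (logarithmic Newton–Leibniz steps unfolded into
one more variable), item stmt-KontsevichZagierPeriods-2840 (`Assembly`, rank 1):

  `LogPrimitiveNL → LogKernelConjecture → KontsevichZagierPeriods`.

The route declaration `Assembly` is the two crux signatures inlined; it is definitionally this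
arrow.  Informal content: given `c : KZ.FormalRep` with `KZ.eval c = 0`, specialise
`LogKernelConjecture` (the kernel of `KZ.eval` lies in every subgroup `R ≥ KZ.relations` closed
under the logarithmic Newton–Leibniz rule) at `R := KZ.relations` (`le_rfl`); closure of
`KZ.relations` under the logarithmic rule is exactly `LogPrimitiveNL`.  Hence `c ∈ KZ.relations`,
i.e. the kernel form `Literature.NumberTheory.Transcendental.KZKernelConjecture`, and the kernel
form implies the summit statement by
`Summit.KontsevichZagierPeriods.KernelForm.kontsevichZagierPeriods_of_kzKernelConjecture`
(`Theorems/KernelFormKernelImpliesStatement.lean`: `value r = value r'` gives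
`eval ([r] - [r']) = 0`).

Both antecedents are hypotheses of the implication: `LogKernelConjecture` is an OPEN conjecture
(summit-strength) and is NOT discharged here; the theorem is the implication, nothing more.

References: M. Kontsevich, D. Zagier, *Periods* (2001), §1.2 (Conjecture 1 and its kernel form);
A. Huber, S. Müller-Stach, *Periods and Nori Motives* (2017), §13.1.
-/

namespace Summit.KontsevichZagierPeriods.LiouvilleUnfolding

/-- **Assembly of route LiouvilleUnfolding** (settles stmt-KontsevichZagierPeriods-2840):
`LogPrimitiveNL → LogKernelConjecture → KontsevichZagierPeriods`.
Given the logarithmic Newton–Leibniz rule as a derived move of the four-move calculus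
(`LogPrimitiveNL`) and the period conjecture for the five-rule calculus (`LogKernelConjecture`:
`ker KZ.eval ⊆ R` for every `R ≥ KZ.relations` closed under the logarithmic rule), take
`R := KZ.relations`: it contains `KZ.relations` (`le_rfl`) and is closed under the logarithmic
rule by `LogPrimitiveNL`, so `ker KZ.eval ⊆ KZ.relations` (the kernel form of Conjecture 1), which
implies `KontsevichZagierPeriods` by
`Summit.KontsevichZagierPeriods.KernelForm.kontsevichZagierPeriods_of_kzKernelConjecture`.
[Kontsevich–Zagier 2001, §1.2; Huber–Müller-Stach 2017, §13.1] [folklore] -/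
theorem assembly_proof :
    Summit.KontsevichZagierPeriods.KontsevichZagierPeriods.Theses.LiouvilleUnfolding.Assembly := by
  unfold Summit.KontsevichZagierPeriods.KontsevichZagierPeriods.Theses.LiouvilleUnfolding.Assembly
  intro hNL hK
  exact Summit.KontsevichZagierPeriods.KernelForm.kontsevichZagierPeriods_of_kzKernelConjecture
    (fun c hc => hK Literature.NumberTheory.Transcendental.KZ.relations le_rfl hNL c hc)

end Summit.KontsevichZagierPeriods.LiouvilleUnfolding
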